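import Summits.QuantumAdvantage.QuantumAdvantage.Theorems.CubicForrelationNearExactIsExactAmmCeilingQ

/-!
# Crux `CubicForrelation.NearExactIsExact` (stmt-QuantumAdvantage-14043) — almost-MM ceiling, part X:
the slices `c_{x₁} = f(x₁ ‖ ·)` of a cubic `f`, their polar entries as AFFINE functions of `x₁`, the
structure at GOOD fibres (four-point lemma) and the first wall (Plücker identities hold everywhere)

Line `direct-sum-amplification`, lead c3 (second helper file for the registered stub `stub_ammCeiling`).
Setting: `f` cubic on `a + (a+2)` bits, `x = x₁ ‖ x₂`.  The polar entries
`B_{ij}(x₁) = f(x₁‖0) ⊕ f(x₁‖e_i) ⊕ f(x₁‖e_j) ⊕ f(x₁‖e_i⊕e_j)` are restricted SECOND derivatives of `f` in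
`x₂`-directions, hence of degree `≤ 1` in `x₁` (stub D twice), i.e. affine; `f(x₁‖e_j) ⊕ f(x₁‖0)` has degree
`≤ 2` and `f(x₁‖0)` degree `≤ 3`.  A fibre `x₁` is GOOD (as in `stub_ammAccounting`) when `φ⁻¹(x₁)` has four
points on which `(−1)^{h} W_{c_{x₁}} = 2^{a+2}/2`; there the four-point lemma (hypothesis FP) makes `c_{x₁}` an
aligned rank-two quadratic, so its polar entries are `u_i v_j ⊕ u_j v_i` and satisfy Plücker.  The Plücker
expressions have degree `≤ 2` in `x₁`; a non-zero Boolean function of degree `≤ d` on `𝔽₂^a` is `true` on at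
least `2^{a−d}` points (stub R), so if fewer than `2^a/4` fibres are bad, Plücker holds at EVERY `x₁`
(`acx_pluecker_all`).

References: C. Carlet, *Boolean Functions for Cryptography and Coding Theory* (CUP 2021), §2.2, §5.1;
F. J. MacWilliams, N. J. A. Sloane, *The Theory of Error-Correcting Codes* (1977), Ch. 13 (Reed–Muller codes).
-/

set_option linter.dupNamespace false -- D-0017: single-problem summit ⇒ `QuantumAdvantage.QuantumAdvantage` by design

noncomputable section

namespace Summit.QuantumAdvantage.QuantumAdvantage.Theorems.CubicForrelation.NearExactIsExact

open Finset
open Literature.Computability.QuantumComplexity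
open Literature.Computability.QuantumComplexity.BuzetChailloux (bxor zeroVec signOf_sq bxor_zeroVec zeroVec_bxor
  bxor_comm bxor_self bxor_bxor_cancel_left twist_zeroVec_right twist_bxor_right sum_twist_left bxor_eq_zeroVec_iff)
open Literature.Computability.QuantumComplexity.DerivativeWalsh (W signOf_not)

variable {a : ℕ}

/-! ### Degrees of slices and of evaluations along the first block -/

/-- Degree bounds are monotone. [folklore] -/
theorem acx_deg_mono {n d d' : ℕ} {F : (Fin n → Bool) → Bool} (h : d ≤ d') (hF : IsDegLeFun d F) : IsDegLeFun d' F := by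
  obtain ⟨p, hp, hpF⟩ := hF
  exact ⟨p, hp.trans h, hpF⟩

/-- The coordinates of `x₁ ↦ (x₁ ‖ c)` have degree `≤ 1`. [folklore] -/
theorem acx_deg_coord_append_right {m n : ℕ} (c : Fin n → Bool) (v : Fin (m + n)) :
    IsDegLeFun 1 (fun x : Fin m → Bool => Fin.append x c v) := by
  induction v using Fin.addCases with
  | left i => simp only [Fin.append_left]; exact isDegLeFun_apply i le_rfl
  | right j => simp only [Fin.append_right]; exact isDegLeFun_const 1 (c j)

/-- A slice `x₂ ↦ F(x₁ ‖ x₂)` has the degree of `F`. [cite: Carlet2020, §2.2] -/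
theorem acx_deg_slice {m n d : ℕ} {F : (Fin (m + n) → Bool) → Bool} (hF : IsDegLeFun d F) (x₁ : Fin m → Bool) :
    IsDegLeFun d (fun x₂ : Fin n → Bool => F (Fin.append x₁ x₂)) :=
  fc_isDegLeFun_comp hF (fun x₂ => Fin.append x₁ x₂) (fun v => fc_deg_coord_append_left x₁ v) (by omega)

/-- An evaluation `x₁ ↦ F(x₁ ‖ c)` has the degree of `F`. [cite: Carlet2020, §2.2] -/
theorem acx_deg_eval {m n d : ℕ} {F : (Fin (m + n) → Bool) → Bool} (hF : IsDegLeFun d F) (c : Fin n → Bool) :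
    IsDegLeFun d (fun x₁ : Fin m → Bool => F (Fin.append x₁ c)) :=
  fc_isDegLeFun_comp hF (fun x₁ => Fin.append x₁ c) (fun v => acx_deg_coord_append_right c v) (by omega)

/-- Translating `x₁ ‖ x₂` by `0 ‖ t` moves only the second block. [folklore] -/
theorem acx_bxor_append_zero {m n : ℕ} (x₁ : Fin m → Bool) (x₂ t : Fin n → Bool) :
    bxor (Fin.append x₁ x₂) (Fin.append zeroVec t) = Fin.append x₁ (bxor x₂ t) := by
  rw [fc_bxor_append, bxor_zeroVec]

/-- Translating `x₁ ‖ x₂` by `t ‖ 0` moves only the first block. [folklore] -/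
theorem acx_bxor_append_zero' {m n : ℕ} (x₁ t : Fin m → Bool) (x₂ : Fin n → Bool) :
    bxor (Fin.append x₁ x₂) (Fin.append t zeroVec) = Fin.append (bxor x₁ t) x₂ := by
  rw [fc_bxor_append, bxor_zeroVec]

/-- **The polar entries are affine in `x₁`**: for cubic `f`,
`x₁ ↦ f(x₁‖0) ⊕ f(x₁‖s) ⊕ f(x₁‖t) ⊕ f(x₁‖s⊕t)` has degree `≤ 1` (a restricted second `x₂`-derivative).
[cite: Carlet2020, §2.2] -/
theorem acx_deg_polar {f : (Fin (a + (a + 2)) → Bool) → Bool} (hf : IsDegLeFun 3 f) (s t : Fin (a + 2) → Bool) :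
    IsDegLeFun 1 (fun x₁ : Fin a → Bool => f (Fin.append x₁ zeroVec) ^^ f (Fin.append x₁ s) ^^
      f (Fin.append x₁ t) ^^ f (Fin.append x₁ (bxor s t))) := by
  have h2 : IsDegLeFun 2 (fun x => f x ^^ f (bxor x (Fin.append zeroVec s))) :=
    stub_derivDegree _ 2 f (Fin.append zeroVec s) hf
  have h1 : IsDegLeFun 1 (fun x => (f x ^^ f (bxor x (Fin.append zeroVec s))) ^^
      (f (bxor x (Fin.append zeroVec t)) ^^ f (bxor (bxor x (Fin.append zeroVec t)) (Fin.append zeroVec s)))) :=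
    stub_derivDegree _ 1 _ (Fin.append zeroVec t) h2
  have key := acx_deg_eval h1 (zeroVec : Fin (a + 2) → Bool)
  refine rm_isDegLeFun_congr key fun x₁ => ?_
  simp only [acx_bxor_append_zero, zeroVec_bxor, bxor_comm t s]
  cases f (Fin.append x₁ zeroVec) <;> cases f (Fin.append x₁ s) <;> cases f (Fin.append x₁ t) <;>
    cases f (Fin.append x₁ (bxor s t)) <;> rfl

/-- `x₁ ↦ f(x₁‖t) ⊕ f(x₁‖0)` has degree `≤ 2` for cubic `f` (a restricted first derivative). [cite: Carlet2020, §2.2] -/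
theorem acx_deg_first {f : (Fin (a + (a + 2)) → Bool) → Bool} (hf : IsDegLeFun 3 f) (t : Fin (a + 2) → Bool) :
    IsDegLeFun 2 (fun x₁ : Fin a → Bool => f (Fin.append x₁ t) ^^ f (Fin.append x₁ zeroVec)) := by
  have h2 : IsDegLeFun 2 (fun x => f x ^^ f (bxor x (Fin.append zeroVec t))) :=
    stub_derivDegree _ 2 f (Fin.append zeroVec t) hf
  have key := acx_deg_eval h2 (zeroVec : Fin (a + 2) → Bool)
  refine rm_isDegLeFun_congr key fun x₁ => ?_
  simp only [acx_bxor_append_zero, zeroVec_bxor]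
  cases f (Fin.append x₁ zeroVec) <;> cases f (Fin.append x₁ t) <;> rfl

/-- All slices are quadratic as soon as one is: `c_{x₁} = c_{x₀} ⊕ (D_{(x₀⊕x₁)‖0} f)(x₀ ‖ ·)`. [cite: Carlet2020, §2.2] -/
theorem acx_slice_quadratic {f : (Fin (a + (a + 2)) → Bool) → Bool} (hf : IsDegLeFun 3 f) {x₀ : Fin a → Bool}
    (h0 : IsDegLeFun 2 (fun x₂ : Fin (a + 2) → Bool => f (Fin.append x₀ x₂))) (x₁ : Fin a → Bool) :
    IsDegLeFun 2 (fun x₂ : Fin (a + 2) → Bool => f (Fin.append x₁ x₂)) := by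
  have hD : IsDegLeFun 2 (fun x => f x ^^ f (bxor x (Fin.append (bxor x₀ x₁) zeroVec))) :=
    stub_derivDegree _ 2 f _ hf
  have hs := acx_deg_slice hD x₀
  have key := fc_deg_bxor h0 hs
  refine rm_isDegLeFun_congr key fun x₂ => ?_
  simp only [acx_bxor_append_zero', bxor_bxor_cancel_left]
  cases f (Fin.append x₀ x₂) <;> cases f (Fin.append x₁ x₂) <;> rfl

/-! ### The wall principle -/

/-- **Wall.** A degree-`≤ d` Boolean function on `𝔽₂^a` that is `true` only on a set `S` with `|S|·2^d < 2^a`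
vanishes identically (Reed–Muller minimum weight, stub R). [cite: MacWilliamsSloane1977, Ch. 13 §3 Thm 3] -/
theorem acx_wall {d : ℕ} {F : (Fin a → Bool) → Bool} (hF : IsDegLeFun d F) (S : Finset (Fin a → Bool))
    (hS : ∀ x, F x = true → x ∈ S) (hcard : S.card * 2 ^ d < 2 ^ a) : ∀ x, F x = false := by
  intro x
  by_contra hx
  have hx' : F x = true := by revert hx; cases F x <;> simp
  have key := stub_rmWeight stub_derivDegree a d F hF ⟨x, hx'⟩
  have hsub : (univ.filter fun y => F y = true) ⊆ S := fun y hy => hS y (mem_filter.1 hy).2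
  have := Finset.card_le_card hsub
  have : 2 ^ d * (univ.filter fun y => F y = true).card ≤ 2 ^ d * S.card := Nat.mul_le_mul_left _ this
  rw [mul_comm (2 ^ d) S.card] at this
  omega

/-! ### Structure of the slice at a GOOD fibre (four-point lemma) -/

/-- From the four-point sign formula to the Boolean ALIGNED form `c x = (u·x)(v·x) ⊕ s·x ⊕ e`. -/
theorem acx_bool_of_sign {k : ℕ} (l : (Fin k → Bool) → (Fin k → Bool) → Bool)
    (hl : ∀ y x, signOf (l y x) = twist x y) {c : (Fin k → Bool) → Bool} {s u v : Fin k → Bool} {e : Bool}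
    (hc : ∀ x, signOf (c x) = signOf e * twist s x * ((1 + twist u x + twist v x - twist u x * twist v x) / 2)) :
    ∀ x, c x = ((l u x && l v x) ^^ l s x ^^ e) := by
  intro x
  apply acq_signOf_inj
  rw [hc x, signOf_xor, signOf_xor, ar_signOf_and, hl, hl, hl, twist_comm s x, twist_comm u x, twist_comm v x]
  ring

/-- The aligned form has degree `≤ 2`. [cite: Carlet2020, §5.1] -/
theorem acx_deg_aligned {k : ℕ} (l : (Fin k → Bool) → (Fin k → Bool) → Bool) (hld : ∀ y, IsDegLeFun 1 (l y))
    {c : (Fin k → Bool) → Bool} {s u v : Fin k → Bool} {e : Bool} (hc : ∀ x, c x = ((l u x && l v x) ^^ l s x ^^ e)) :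
    IsDegLeFun 2 c := by
  have h : IsDegLeFun 2 (fun x => (l u x && l v x) ^^ l s x ^^ e) :=
    fc_deg_bxor (fc_deg_bxor (acq_deg_band (hld u) (hld v) le_rfl) (acx_deg_mono (by norm_num) (hld s)))
      (isDegLeFun_const 2 e)
  exact rm_isDegLeFun_congr h fun x => (hc x).symm

/-- Peel four distinct elements off a finset of cardinality `4`. [folklore] -/
theorem acx_card_eq_four {α : Type*} [DecidableEq α] {S : Finset α} (h : S.card = 4) :
    ∃ y₁ y₂ y₃ y₄ : α, y₁ ≠ y₂ ∧ y₁ ≠ y₃ ∧ y₁ ≠ y₄ ∧ y₂ ≠ y₃ ∧ y₂ ≠ y₄ ∧ y₃ ≠ y₄ ∧ S = {y₁, y₂, y₃, y₄} := by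
  obtain ⟨y₁, T, hy₁, rfl, hT⟩ := Finset.card_eq_succ.1 h
  obtain ⟨y₂, y₃, y₄, h23, h24, h34, rfl⟩ := Finset.card_eq_three.1 hT
  simp only [mem_insert, mem_singleton, not_or] at hy₁
  exact ⟨y₁, y₂, y₃, y₄, hy₁.1, hy₁.2.1, hy₁.2.2, h23, h24, h34, rfl⟩

/-- **Structure at a GOOD fibre.** If the fibre `φ⁻¹(x₁)` has exactly four points and
`(−1)^{h y} W_{c_{x₁}}(y) = 2^{a+2}/2` on each of them, the four-point lemma (hypothesis) makes the slice an aligned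
rank-two quadratic whose corner flat IS the fibre. -/
theorem acx_good_structure
    (hFP : ∀ (k : ℕ) (c : (Fin k → Bool) → Bool) (y₁ y₂ y₃ y₄ : Fin k → Bool), IsDegLeFun 3 c →
      y₁ ≠ y₂ → y₁ ≠ y₃ → y₁ ≠ y₄ → y₂ ≠ y₃ → y₂ ≠ y₄ → y₃ ≠ y₄ →
      (15 / 8 : ℝ) * (2 : ℝ) ^ k < |W (fun x => signOf (c x)) y₁| + |W (fun x => signOf (c x)) y₂| +
        |W (fun x => signOf (c x)) y₃| + |W (fun x => signOf (c x)) y₄| →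
      ∃ (s u v : Fin k → Bool) (e : Bool), u ≠ zeroVec ∧ v ≠ zeroVec ∧ u ≠ v ∧
        (∀ x, signOf (c x) = signOf e * twist s x * ((1 + twist u x + twist v x - twist u x * twist v x) / 2)) ∧
        ({y₁, y₂, y₃, y₄} : Finset (Fin k → Bool)) = {s, bxor s u, bxor s v, bxor s (bxor u v)})
    (l : (Fin (a + 2) → Bool) → (Fin (a + 2) → Bool) → Bool) (hl : ∀ y x, signOf (l y x) = twist x y)
    {f : (Fin (a + (a + 2)) → Bool) → Bool} (hf : IsDegLeFun 3 f) (φ : (Fin (a + 2) → Bool) → (Fin a → Bool))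
    (h : (Fin (a + 2) → Bool) → Bool) (x₁ : Fin a → Bool)
    (hcard : (univ.filter fun y : Fin (a + 2) → Bool => φ y = x₁).card = 4)
    (hT : ∀ y : Fin (a + 2) → Bool, φ y = x₁ →
      signOf (h y) * W (fun x₂ => signOf (f (Fin.append x₁ x₂))) y = (2 : ℝ) ^ (a + 2) / 2) :
    ∃ (s u v : Fin (a + 2) → Bool) (e : Bool), u ≠ zeroVec ∧ v ≠ zeroVec ∧ u ≠ v ∧
      (∀ x₂, f (Fin.append x₁ x₂) = ((l u x₂ && l v x₂) ^^ l s x₂ ^^ e)) ∧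
      (univ.filter fun y : Fin (a + 2) → Bool => φ y = x₁) = {s, bxor s u, bxor s v, bxor s (bxor u v)} := by
  obtain ⟨y₁, y₂, y₃, y₄, h12, h13, h14, h23, h24, h34, hS⟩ := acx_card_eq_four hcard
  have hmem : ∀ y, y ∈ (univ.filter fun y : Fin (a + 2) → Bool => φ y = x₁) → φ y = x₁ :=
    fun y hy => (mem_filter.1 hy).2
  have habs : ∀ y, φ y = x₁ → |W (fun x₂ => signOf (f (Fin.append x₁ x₂))) y| = (2 : ℝ) ^ (a + 2) / 2 := by
    intro y hy
    have e1 := hT y hy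
    have e2 : |signOf (h y) * W (fun x₂ => signOf (f (Fin.append x₁ x₂))) y| = (2 : ℝ) ^ (a + 2) / 2 := by
      rw [e1]; exact abs_of_pos (by positivity)
    rwa [abs_mul, abs_signOf, one_mul] at e2
  have hy1 : φ y₁ = x₁ := hmem y₁ (by rw [hS]; simp)
  have hy2 : φ y₂ = x₁ := hmem y₂ (by rw [hS]; simp)
  have hy3 : φ y₃ = x₁ := hmem y₃ (by rw [hS]; simp)
  have hy4 : φ y₄ = x₁ := hmem y₄ (by rw [hS]; simp)
  have hsum : (15 / 8 : ℝ) * (2 : ℝ) ^ (a + 2) <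
      |W (fun x₂ => signOf (f (Fin.append x₁ x₂))) y₁| + |W (fun x₂ => signOf (f (Fin.append x₁ x₂))) y₂| +
      |W (fun x₂ => signOf (f (Fin.append x₁ x₂))) y₃| + |W (fun x₂ => signOf (f (Fin.append x₁ x₂))) y₄| := by
    rw [habs y₁ hy1, habs y₂ hy2, habs y₃ hy3, habs y₄ hy4]
    have : (0 : ℝ) < (2 : ℝ) ^ (a + 2) := by positivity
    nlinarith
  obtain ⟨s, u, v, e, hu, hv, huv, hsign, hflat⟩ :=
    hFP (a + 2) (fun x₂ => f (Fin.append x₁ x₂)) y₁ y₂ y₃ y₄ (acx_deg_slice hf x₁) h12 h13 h14 h23 h24 h34 hsum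
  refine ⟨s, u, v, e, hu, hv, huv, acx_bool_of_sign l hl hsign, ?_⟩
  rw [hS, hflat]

/-! ### The first wall: the Plücker identities hold at every `x₁` -/

/-- **Plücker everywhere.** With fewer than `2^a/4` bad fibres, the Plücker identities of the polar entries
`B_{ij}(x₁)` (degree `≤ 2` in `x₁`, vanishing at every good fibre) hold at EVERY `x₁`. -/
theorem acx_pluecker_all
    (hFP : ∀ (k : ℕ) (c : (Fin k → Bool) → Bool) (y₁ y₂ y₃ y₄ : Fin k → Bool), IsDegLeFun 3 c →
      y₁ ≠ y₂ → y₁ ≠ y₃ → y₁ ≠ y₄ → y₂ ≠ y₃ → y₂ ≠ y₄ → y₃ ≠ y₄ →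
      (15 / 8 : ℝ) * (2 : ℝ) ^ k < |W (fun x => signOf (c x)) y₁| + |W (fun x => signOf (c x)) y₂| +
        |W (fun x => signOf (c x)) y₃| + |W (fun x => signOf (c x)) y₄| →
      ∃ (s u v : Fin k → Bool) (e : Bool), u ≠ zeroVec ∧ v ≠ zeroVec ∧ u ≠ v ∧
        (∀ x, signOf (c x) = signOf e * twist s x * ((1 + twist u x + twist v x - twist u x * twist v x) / 2)) ∧
        ({y₁, y₂, y₃, y₄} : Finset (Fin k → Bool)) = {s, bxor s u, bxor s v, bxor s (bxor u v)})
    {f : (Fin (a + (a + 2)) → Bool) → Bool} (hf : IsDegLeFun 3 f) (φ : (Fin (a + 2) → Bool) → (Fin a → Bool))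
    (h : (Fin (a + 2) → Bool) → Bool)
    (hbad : (univ.filter fun x₁ : Fin a → Bool => ¬ ((univ.filter fun y : Fin (a + 2) → Bool => φ y = x₁).card = 4 ∧
        ∀ y : Fin (a + 2) → Bool, φ y = x₁ →
          signOf (h y) * W (fun x₂ => signOf (f (Fin.append x₁ x₂))) y = (2 : ℝ) ^ (a + 2) / 2)).card * 4 < 2 ^ a)
    (x₁ : Fin a → Bool) (i j i' j' : Fin (a + 2)) :
    (((f (Fin.append x₁ zeroVec) ^^ f (Fin.append x₁ (Pi.single i true)) ^^ f (Fin.append x₁ (Pi.single j true)) ^^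
          f (Fin.append x₁ (bxor (Pi.single i true) (Pi.single j true)))) &&
        (f (Fin.append x₁ zeroVec) ^^ f (Fin.append x₁ (Pi.single i' true)) ^^ f (Fin.append x₁ (Pi.single j' true)) ^^
          f (Fin.append x₁ (bxor (Pi.single i' true) (Pi.single j' true))))) ^^
      ((f (Fin.append x₁ zeroVec) ^^ f (Fin.append x₁ (Pi.single i true)) ^^ f (Fin.append x₁ (Pi.single i' true)) ^^
          f (Fin.append x₁ (bxor (Pi.single i true) (Pi.single i' true)))) &&
        (f (Fin.append x₁ zeroVec) ^^ f (Fin.append x₁ (Pi.single j true)) ^^ f (Fin.append x₁ (Pi.single j' true)) ^^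
          f (Fin.append x₁ (bxor (Pi.single j true) (Pi.single j' true))))) ^^
      ((f (Fin.append x₁ zeroVec) ^^ f (Fin.append x₁ (Pi.single i true)) ^^ f (Fin.append x₁ (Pi.single j' true)) ^^
          f (Fin.append x₁ (bxor (Pi.single i true) (Pi.single j' true)))) &&
        (f (Fin.append x₁ zeroVec) ^^ f (Fin.append x₁ (Pi.single j true)) ^^ f (Fin.append x₁ (Pi.single i' true)) ^^
          f (Fin.append x₁ (bxor (Pi.single j true) (Pi.single i' true)))))) = false := by
  obtain ⟨l, hld, hl⟩ := fc_linForm_exists (a + 2)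
  -- the Plücker expression as a function of x₁, of degree ≤ 2
  set B : (Fin a → Bool) → Fin (a + 2) → Fin (a + 2) → Bool := fun x p q =>
    f (Fin.append x zeroVec) ^^ f (Fin.append x (Pi.single p true)) ^^ f (Fin.append x (Pi.single q true)) ^^
      f (Fin.append x (bxor (Pi.single p true) (Pi.single q true))) with hB
  have hBdeg : ∀ p q, IsDegLeFun 1 (fun x => B x p q) := fun p q => acx_deg_polar hf _ _
  set P : (Fin a → Bool) → Bool := fun x =>
    ((B x i j && B x i' j') ^^ (B x i i' && B x j j') ^^ (B x i j' && B x j i')) with hP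
  have hPdeg : IsDegLeFun 2 P :=
    fc_deg_bxor (fc_deg_bxor (acq_deg_band (hBdeg i j) (hBdeg i' j') le_rfl)
      (acq_deg_band (hBdeg i i') (hBdeg j j') le_rfl)) (acq_deg_band (hBdeg i j') (hBdeg j i') le_rfl)
  -- P vanishes at every good fibre
  have hgood : ∀ x, P x = true → x ∈ (univ.filter fun x₁ : Fin a → Bool =>
      ¬ ((univ.filter fun y : Fin (a + 2) → Bool => φ y = x₁).card = 4 ∧
        ∀ y : Fin (a + 2) → Bool, φ y = x₁ →
          signOf (h y) * W (fun x₂ => signOf (f (Fin.append x₁ x₂))) y = (2 : ℝ) ^ (a + 2) / 2)) := by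
    intro x hx
    rw [mem_filter]
    refine ⟨mem_univ _, fun hG => ?_⟩
    obtain ⟨s, u, v, e, -, -, -, hc, -⟩ := acx_good_structure hFP l hl hf φ h x hG.1 hG.2
    have hent : ∀ p q, B x p q = ((u p && v q) ^^ (u q && v p)) := fun p q => acq_polar_aligned l hl hc p q
    have : P x = false := by
      show ((B x i j && B x i' j') ^^ (B x i i' && B x j j') ^^ (B x i j' && B x j i')) = false
      rw [hent, hent, hent, hent, hent, hent]
      exact acq_pluecker_rank_two u v i j i' j'
    rw [this] at hx
    exact Bool.false_ne_true hx
  have key := acx_wall hPdeg _ hgood (by simpa using hbad) x₁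
  exact key

/-- **Wall principle** (registered helper-stub form of `acx_wall`). [cite: MacWilliamsSloane1977, Ch. 13 §3 Thm 3] -/
theorem acx_wallStub : ∀ {a d : ℕ} {F : (Fin a → Bool) → Bool}, IsDegLeFun d F → ∀ (S : Finset (Fin a → Bool)), (∀ x, F x = true → x ∈ S) → S.card * 2 ^ d < 2 ^ a → ∀ x, F x = false := by
  intro a d F hF S hS hcard
  exact acx_wall hF S hS hcard

end Summit.QuantumAdvantage.QuantumAdvantage.Theorems.CubicForrelation.NearExactIsExact

end
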